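import Summits.NavierStokesRegularity.NavierStokesRegularity.Theorems.TerminalTraceTypeITraceScarL3ExtinctApexPressureUnitConst
import Summits.NavierStokesRegularity.NavierStokesRegularity.Theorems.TerminalTraceTypeITraceScarL3StubExtinctApexOfL3Trace
import Literature.Analysis.FluidPDE.NSViscosityRescaling
import Literature.Analysis.FluidPDE.NSLerayHopfABCScaling
import HarnessLib

/-!
# Line `annulus-dichotomy` of `TerminalTrace.TypeITraceScarL3` (stmt-NavierStokesRegularity-18385) —
# the CONSTANT-EXPOSED Stub 2′ `ExtinctApexDOfL3TraceConst` of ROUND-27 «THE √2 APEX» (T-27.1 (e))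

Seat nsreg-C26-p1 g2 (cell ns-regularity-ideate), `--supports stmt-NavierStokesRegularity-18385` (helper);
planner-of-record nsreg-p2 g29 (companion `R27-sqrt2-apex.lean` v2 1e24a2a485d38e8d, l.814
`def ExtinctApexDOfL3TraceConst` / l.838 `target_extinctApexD_of_L3trace_const`, size S; DIRECTOR-NS #103 (1)(e)).

* `extinctApexD_of_L3trace_const` — the statement of `ExtinctApexDOfL3TraceConst` VERBATIM (unfolded): in the
  frame of the item (`ν, T > 0`, classical on `[0, T)`, Leray–Hopf on `[0, T]`), for an EVENTUAL TYPE-I RATE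
  `‖u(t,x)‖ ≤ C/√(T−t)` with a given constant `C ≥ 0`, at a backward-singular apex `(T, x₀)` with
  `u(T) ∈ L³(B(x₀, ρ))` there is an extinct Type-I apex `(U, P, G, M, D₀)` of class `(M, D₀, C/√ν)` — suitable
  in every `Q(a)` with weak gradient, `𝐈(Q(a)) ≤ M`, plain `cknD r z₀ P ≤ D₀` at every apex `z₀.1 ≤ 0`, rate
  `(C/√ν)/√(−s)`, weakly vanishing top — backward-singular at the origin.  Proof = the tree's Stub 2′
  `stub_extinctApexD_of_L3trace` (`…StubExtinctApexDOfL3Trace`, ns-typeII-p3 g9) with the constant carried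
  through: the viscosity normalisation `v(s, x) = ν⁻¹ u(s/ν, x)` has eventual rate `(C/√ν)/√(νT − s)`, and
  `extinctApexD_of_L3trace_unit_const` keeps that constant.  This is the hypothesis `hZ` of the conditional
  record `typeITraceScarL3_of_rateSq_lt_two_nu` (`…SqrtTwoApexWindow`): with it, T27-C (item 18385 for every
  blow-up whose eventual Type-I constant has `C² < 2ν`) is a tree theorem MODULO T27-A alone.

WHAT THIS IS NOT: not T27-A, not Stub LOUD, not item 18385, not NS regularity.  [folklore; AlbrittonBarker2019
§3; SereginSverak2009 (as13); WangZhang2016 §4; Seregin2014 §6.6; Tao 2013 footnote 3]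
-/

noncomputable section

set_option linter.dupNamespace false

namespace Summit.NavierStokesRegularity.NavierStokesRegularity.Theorems.TypeITraceScarL3

open MeasureTheory Set Function Filter Topology TopologicalSpace Metric
open Literature.Analysis.FluidPDE
open scoped NNReal ENNReal InnerProductSpace RealInnerProductSpace

/-- **Constant-exposed Stub 2′ (`ExtinctApexDOfL3TraceConst` of ROUND-27, verbatim).**  A backward-singular apex
of a classical Leray–Hopf flow on `[0,T)` with EVENTUAL Type-I constant `C ≥ 0` and an `L³` terminal trace
near `x₀` yields, after ν-normalisation and a parabolic zoom along a subsequence, an extinct Type-I apex of class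
`(M, D₀, C/√ν)` that is backward singular at the origin (module docstring).  The local Albritton–Barker bound
among the hypotheses is not needed.
[folklore; AlbrittonBarker2019 §3 Rem. 3.2; SereginSverak2009 (as13); WangZhang2016 §4 (4.3)–(4.4); Seregin2014 §6.6 Prop. 6.20] -/
theorem extinctApexD_of_L3trace_const :
    ∀ (ν T : ℝ), 0 < ν → 0 < T →
      ∀ (u : ℝ → EuclideanSpace ℝ (Fin 3) → EuclideanSpace ℝ (Fin 3))
        (p : ℝ → EuclideanSpace ℝ (Fin 3) → ℝ),
      IsClassicalNSSolutionOn (Ico 0 T) ν 0 u p → IsLerayHopfOn T ν 0 (u 0) u →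
      ∀ C : ℝ, 0 ≤ C → (∀ᶠ t in 𝓝[<] T, ∀ x, ‖u t x‖ ≤ C / Real.sqrt (T - t)) →
      ∀ x₀ : EuclideanSpace ℝ (Fin 3),
      (∃ r₀ : ℝ, 0 < r₀ ∧
        ∃ G : ℝ → EuclideanSpace ℝ (Fin 3) →
          EuclideanSpace ℝ (Fin 3) →L[ℝ] EuclideanSpace ℝ (Fin 3),
          HasWeakSpatialGradientOn (parabolicCylinderOpens r₀ (T, x₀)) u G ∧
          typeIBound (parabolicCylinder r₀ (T, x₀)) u p G < ⊤) →
      (∀ r : ℝ, 0 < r →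
        eLpNorm (uncurry u) ⊤ (volume.restrict (parabolicCylinder r (T, x₀))) = ⊤) →
      (∃ ρ : ℝ, 0 < ρ ∧ MemLp (u T) 3 (volume.restrict (ball x₀ ρ))) →
        ∃ (U : ℝ → EuclideanSpace ℝ (Fin 3) → EuclideanSpace ℝ (Fin 3))
          (P : ℝ → EuclideanSpace ℝ (Fin 3) → ℝ)
          (G : ℝ → EuclideanSpace ℝ (Fin 3) →
            EuclideanSpace ℝ (Fin 3) →L[ℝ] EuclideanSpace ℝ (Fin 3))
          (M D₀ : ℝ≥0),
          (∀ a : ℝ, 0 < a →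
            IsSuitableWeakSolutionInBall a (0 : ℝ × EuclideanSpace ℝ (Fin 3)) U P) ∧
          (∀ a : ℝ, 0 < a →
            HasWeakSpatialGradientOn
              (parabolicCylinderOpens a (0 : ℝ × EuclideanSpace ℝ (Fin 3))) U G) ∧
          (∀ a : ℝ, 0 < a →
            typeIBound (parabolicCylinder a (0 : ℝ × EuclideanSpace ℝ (Fin 3))) U P G ≤ M) ∧
          (∀ z₀ : ℝ × EuclideanSpace ℝ (Fin 3), z₀.1 ≤ 0 →
            ∀ r : ℝ, 0 < r → cknD r z₀ P ≤ D₀) ∧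
          (∀ s : ℝ, s < 0 →
            ∀ᵐ y : EuclideanSpace ℝ (Fin 3), ‖U s y‖ ≤ (C / Real.sqrt ν) / Real.sqrt (-s)) ∧
          (∀ φ : EuclideanSpace ℝ (Fin 3) → EuclideanSpace ℝ (Fin 3),
            ContDiff ℝ (⊤ : ℕ∞) φ →
            HasCompactSupport φ → ∀ ε : ℝ, 0 < ε →
            ∃ s₀ : ℝ, s₀ < 0 ∧ ∀ᵐ s ∂(volume.restrict (Ioo s₀ 0)), |∫ y, ⟪U s y, φ y⟫| ≤ ε) ∧
          IsBackwardSingularPoint U (0 : ℝ × EuclideanSpace ℝ (Fin 3)) := by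
  intro ν T hν hT u p hcl hLH C hC0 hC x₀ _ hsing htr
  -- verbatim `stub_extinctApexD_of_L3trace` (…StubExtinctApexDOfL3Trace) with the constant carried through
  obtain ⟨ρ, hρ, hmem⟩ := htr
  have hν0 : ν ≠ 0 := hν.ne'
  have hνi : 0 < ν⁻¹ := inv_pos.2 hν
  have hνT : 0 < ν * T := mul_pos hν hT
  -- the apex is not backward bounded
  have hnotbd : ¬ IsBackwardBoundedAt u T x₀ := not_isBackwardBoundedAt_of_forall_eLpNorm_top hsing
  -- ## viscosity normalisation `v(s, x) = ν⁻¹ u(s/ν, x)`, blow-up time `νT`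
  set v : ℝ → EuclideanSpace ℝ (Fin 3) → EuclideanSpace ℝ (Fin 3) := timeRescale ν⁻¹ ν⁻¹ u with hv
  set pv : ℝ → EuclideanSpace ℝ (Fin 3) → ℝ := timeRescale ν⁻¹ (ν⁻¹ ^ 2) p with hpv
  have hmaps : MapsTo (fun s => ν⁻¹ * s) (Ico 0 (ν * T)) (Ico 0 T) := by
    intro s hs
    refine ⟨mul_nonneg hνi.le hs.1, ?_⟩
    calc ν⁻¹ * s < ν⁻¹ * (ν * T) := mul_lt_mul_of_pos_left hs.2 hνi
      _ = T := by rw [← mul_assoc, inv_mul_cancel₀ hν0, one_mul]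
  -- (1) classical at viscosity 1 on `[0, νT)`
  have hclv : IsClassicalNSSolutionOn (Ico 0 (ν * T)) 1 0 v pv := by
    have h := hcl.viscosityRescale_set hν0 hmaps (uniqueDiffOn_Ico 0 (ν * T))
    rwa [timeRescale_zero_force] at h
  -- (2) Leray–Hopf on `[0, νT]`
  have hv0 : ν⁻¹ • u 0 = v 0 := by
    funext x
    simp [hv]
  have hLHv : IsLerayHopfOn (ν * T) 1 0 (v 0) v := by
    have h := hLH.viscosityRescale hνi
    have e1 : T / ν⁻¹ = ν * T := by rw [div_inv_eq_mul, mul_comm]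
    rwa [e1, inv_mul_cancel₀ hν0, timeRescale_zero_force, hv0] at h
  -- (3) the eventual Type-I rate of `v` with constant `C/√ν`
  have e0 : ν⁻¹ * (ν * T) = T := by rw [← mul_assoc, inv_mul_cancel₀ hν0, one_mul]
  have htend : Tendsto (fun s : ℝ => ν⁻¹ * s) (𝓝[<] (ν * T)) (𝓝[<] T) := by
    refine tendsto_nhdsWithin_of_tendsto_nhds_of_eventually_within _ ?_ ?_
    · have h := ((continuous_const_mul ν⁻¹).tendsto (ν * T)).mono_left
        (nhdsWithin_le_nhds (s := Iio (ν * T)))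
      rwa [e0] at h
    · refine eventually_nhdsWithin_of_forall fun s hs => ?_
      have h := mul_lt_mul_of_pos_left (mem_Iio.1 hs) hνi
      rwa [e0] at h
  have hIv : ∀ᶠ s in 𝓝[<] (ν * T), ∀ x, ‖v s x‖ ≤ (C / Real.sqrt ν) / Real.sqrt (ν * T - s) := by
    filter_upwards [htend.eventually hC, self_mem_nhdsWithin] with s hs hsT x
    have hsT' : s < ν * T := hsT
    have hpos : 0 < ν * T - s := sub_pos.2 hsT'
    have e : T - ν⁻¹ * s = ν⁻¹ * (ν * T - s) := by field_simp
    have hsq : Real.sqrt (T - ν⁻¹ * s) = (Real.sqrt ν)⁻¹ * Real.sqrt (ν * T - s) := by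
      rw [e, Real.sqrt_mul hνi.le, Real.sqrt_inv]
    have hb := hs x
    rw [hsq] at hb
    have hsν : 0 < Real.sqrt ν := Real.sqrt_pos.2 hν
    have hsνsq : Real.sqrt ν * Real.sqrt ν = ν := Real.mul_self_sqrt hν.le
    have hsqpos : 0 < Real.sqrt (ν * T - s) := Real.sqrt_pos.2 hpos
    rw [le_div_iff₀ (by positivity)] at hb
    have hνinv : ν⁻¹ = (Real.sqrt ν)⁻¹ * (Real.sqrt ν)⁻¹ := by rw [← mul_inv, hsνsq]
    have key : ν⁻¹ * ‖u (ν⁻¹ * s) x‖ ≤ C / Real.sqrt ν / Real.sqrt (ν * T - s) := by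
      rw [le_div_iff₀ hsqpos]
      calc ν⁻¹ * ‖u (ν⁻¹ * s) x‖ * Real.sqrt (ν * T - s)
          = (Real.sqrt ν)⁻¹ * (‖u (ν⁻¹ * s) x‖ * ((Real.sqrt ν)⁻¹ * Real.sqrt (ν * T - s))) := by
              rw [hνinv]; ring
        _ ≤ (Real.sqrt ν)⁻¹ * C := mul_le_mul_of_nonneg_left hb (inv_nonneg.2 hsν.le)
        _ = C / Real.sqrt ν := by rw [div_eq_inv_mul]
    have e2 : ‖v s x‖ = ν⁻¹ * ‖u (ν⁻¹ * s) x‖ := by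
      rw [hv, timeRescale_apply, norm_smul, Real.norm_eq_abs, abs_of_pos hνi]
    exact e2 ▸ key
  have hC1 : 0 ≤ C / Real.sqrt ν := div_nonneg hC0 (Real.sqrt_nonneg _)
  -- (4) the apex is not backward bounded for `v` either
  have hnotbdv : ¬ IsBackwardBoundedAt v (ν * T) x₀ := not_isBackwardBoundedAt_viscosityRescale hν hnotbd
  -- (5) the `L³` ball of the final value: `v(νT) = ν⁻¹ u(T)`
  have hmemv : MemLp (v (ν * T)) 3 (volume.restrict (ball x₀ ρ)) := by
    have e : v (ν * T) = fun x => ν⁻¹ • u T x := by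
      funext x
      rw [hv, timeRescale_apply, ← mul_assoc, inv_mul_cancel₀ hν0, one_mul]
    rw [e]
    exact hmem.const_smul ν⁻¹
  -- ## the unit-viscosity theorem with the constant exposed
  exact extinctApexD_of_L3trace_unit_const hνT hclv hLHv hC1 hIv x₀ hnotbdv hρ hmemv

end Summit.NavierStokesRegularity.NavierStokesRegularity.Theorems.TypeITraceScarL3

end
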